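import Literature.Computability.QuantumComplexity.PromiseClassesRel
import Literature.Computability.QuantumComplexity.CountingSimulationRelProofs
import Literature.Barriers.QuantumAdvantage.RandomOracleMethodProofs
import Literature.Barriers.QuantumAdvantage.PromiseLiftRelativization
import Literature.Barriers.PneNP.RelativizationProofs
import Summits.QuantumAdvantage.QuantumAdvantage.Statement
import HarnessLib

/-!
# The quantum rung relative to a random oracle: quantum Hypothesis III at measure one refutes the summit

Solo seat `solo-QuantumAdvantage-informed`, session 7, file 21; the quantum entries of the
random-oracle column of the door table (classical entries: Literature `PromiseBPPRelAlmostP` and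
file 20 `SoloInformedFloorRandomOracle`).

Relative to a random oracle `A` the CLASSICAL floor of the door holds with probability `1`
(Bennett–Gill in promise form: `∀ᵐ A, PromiseBPP'^A ⊆ promiseLift P^A`). Its QUANTUM analogue

  `Q-III^A := PromiseBQP^A ⊆ promiseLift P^A`  (every promise-BQP^A problem has a P^A-language solution)

cannot hold with probability `1` unless the summit is false: on trivial promises it gives
`BQP^A = P^A` a.e., which Fortnow–Rogers (Thm. 4.4, tree theorem `fortnowRogers1999_thm44_holds`)
descend to `BQP = BPP`. So, GRANTED THE SUMMIT, relative to a random oracle with positive probability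
some `PromiseBQP^A` problem has no `P^A`-language solution while (a.e.) every `PromiseBPP'^A`
problem has one — the doors separate in the random world exactly at the quantum rung. The door
itself, `Q-EXT^A := PromiseBQP^A ⊆ promiseLift BQP^A`, sits between (`Q-III^A → Q-EXT^A`) and its
measure-one status stays open; what is recorded here is the relativised assembly
`Q-EXT^A ∧ PSep'^A → summit^A` at every oracle and at measure one.

* `PRel_eq_BQPRel_of_quantumIII`: `Q-III^A → P^A = BQP^A` (trivial promises).
* `not_quantumAdvantage_of_ae_quantumIII`: `(∀ᵐ A, Q-III^A) → ¬ QuantumAdvantage`;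
  `not_ae_quantumIII_of_quantumAdvantage`, `not_aeRelativizes_quantumIII_of_quantumAdvantage`.
* `quantumIII_imp_promiseIsLiftRel`: `Q-III^A → Q-EXT^A`.
* `summitRel_of_promiseIsLiftRel`: `Q-EXT^A → ¬(PromiseBQP^A ⊆ PromiseBPP'^A) → ∃ L ∈ BQP^A, L ∉ BPP^A`
  (file 1 relativised), and its measure-one form `ae_summitRel_of_ae`.

## References
* [FortnowRogers1999JCSS] L. Fortnow, J. Rogers, *Complexity limitations on quantum computation*,
  JCSS 59 (1999), Thm. 4.4 (arXiv numbering) — tree `Literature.Barriers.QuantumAdvantage.RandomOracleMethod`.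
* [BennettGill1981] C. H. Bennett, J. Gill, SIAM J. Comput. 10 (1981), Thm. 5 and Lemma 1.
* [AaronsonAmbainis2014] S. Aaronson, A. Ambainis, *The need for structure in quantum speedups*,
  Theory Comput. 10 (2014), Thm. 7 (iii) [corpus: paper:arxiv-0911.0996].
* [Goldreich2006] O. Goldreich, *On promise problems: a survey*, LNCS 3895 (2006), Def. 1.2.
-/

noncomputable section

namespace Summit.QuantumAdvantage.QuantumAdvantage.Theorems

open _root_.MeasureTheory _root_.Computability Literature.Computability.Complexity
  Literature.Computability.Complexity.Classes Literature.Computability.Cryptography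
  Literature.Computability.QuantumComplexity Literature.Barriers.PneNP
  Literature.Barriers.QuantumAdvantage

/-! ### Quantum Hypothesis III on trivial promises -/

/-- **`Q-III^A` collapses `BQP^A` to `P^A`**: if every `PromiseBQP^A` problem has a `P^A`-language
solution then `P^A = BQP^A` (apply it to `⟨L, Lᶜ⟩`; `P^A ⊆ BQP^A` is the tree theorem
`PRel_ofLanguage_subset_BQPRel_holds`). [cite: Goldreich2006, Def. 1.2 and §1.1] -/
theorem PRel_eq_BQPRel_of_quantumIII {A : Language Bool}
    (h : PromiseBQPRel A ⊆ promiseLift (PRel (Oracle.ofLanguage A))) :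
    PRel (Oracle.ofLanguage A) = BQPRel A := by
  refine Set.Subset.antisymm (PRel_ofLanguage_subset_BQPRel_holds A) fun L hL => ?_
  exact ofLanguage_mem_promiseLift_iff.1 (h (ofLanguage_mem_PromiseBQPRel_iff.2 hL))

/-- **Quantum Hypothesis III at measure one refutes the summit.** If for almost every oracle `A`
every `PromiseBQP^A` problem is solved by a `P^A` language, then `BQP = BPP` (Fortnow–Rogers
Thm. 4.4 applied to the trivial-promise collapse), hence `¬ QuantumAdvantage`.
[cite: FortnowRogers1999JCSS, Thm. 4.4 (arXiv numbering)] -/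
theorem not_quantumAdvantage_of_ae_quantumIII
    (h : ∀ᵐ A : Set (List Bool) ∂randomOracleMeasure,
      PromiseBQPRel A ⊆ promiseLift (PRel (Oracle.ofLanguage A))) :
    ¬ QuantumAdvantage := by
  have hae : ∀ᵐ A : Set (List Bool) ∂randomOracleMeasure,
      PRel (Oracle.ofLanguage (A : Language Bool)) = BQPRel (A : Language Bool) := by
    filter_upwards [h] with A hA
    exact PRel_eq_BQPRel_of_quantumIII hA
  have hEq : BQP = BPP := fortnowRogers1999_thm44_holds hae
  rintro ⟨L, hL, hnL⟩
  exact hnL (hEq ▸ hL)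

/-- Contrapositive: **under the summit, quantum Hypothesis III fails on a set of oracles of positive
measure** — while classical Hypothesis III holds almost everywhere (Literature
`promiseBPP'Rel_subset_promiseLift_PRel_ae`). [cite: FortnowRogers1999JCSS, Thm. 4.4 (arXiv numbering)] [cite: BennettGill1981, Thm. 5] -/
theorem not_ae_quantumIII_of_quantumAdvantage (hS : QuantumAdvantage) :
    ¬ ∀ᵐ A : Set (List Bool) ∂randomOracleMeasure,
      PromiseBQPRel A ⊆ promiseLift (PRel (Oracle.ofLanguage A)) :=
  fun h => not_quantumAdvantage_of_ae_quantumIII h hS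

/-- The same in the measure-one technique class, for every presentation `PC` of relativised
`PromiseBQP` agreeing with `PromiseBQPRel` on language oracles: under the summit,
`O ↦ PC O ⊆ promiseLift (P^O)` does not hold relative to a random oracle. [cite: Fortnow1994, §6] [cite: FortnowRogers1999JCSS, Thm. 4.4 (arXiv numbering)] -/
theorem not_aeRelativizes_quantumIII_of_quantumAdvantage (hS : QuantumAdvantage)
    {PC : Oracle → Set PromiseProblem} (hPC : PresentsPromiseBQPRel PC) :
    ¬ AERelativizes fun O => PC O ⊆ promiseLift (PRel O) := by
  intro h
  refine not_ae_quantumIII_of_quantumAdvantage hS ?_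
  have h' : ∀ᵐ A : Set (List Bool) ∂randomOracleMeasure,
      PC (Oracle.ofLanguage A) ⊆ promiseLift (PRel (Oracle.ofLanguage A)) := h
  filter_upwards [h'] with A hA
  rwa [hPC A] at hA

/-! ### The door between: `Q-III^A → Q-EXT^A`, and the relativised assembly -/

/-- `Q-III^A → Q-EXT^A`: a `P^A`-language solution is a `BQP^A`-language solution.
[cite: Goldreich2006, Def. 1.2] -/
theorem quantumIII_imp_promiseIsLiftRel {A : Language Bool}
    (h : PromiseBQPRel A ⊆ promiseLift (PRel (Oracle.ofLanguage A))) :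
    PromiseBQPRel A ⊆ promiseLift (BQPRel A) :=
  h.trans (promiseLift_mono (PRel_ofLanguage_subset_BQPRel_holds A))

/-- **The assembly of file 1, relativised**: at every oracle, `Q-EXT^A` and the weak promise
separation `PromiseBQP^A ⊄ PromiseBPP'^A` give a `BQP^A` language outside `BPP^A`
(`promiseLift BPP^A ⊆ PromiseBPP'^A`, tree). [cite: Goldreich2006, Def. 1.2] -/
theorem summitRel_of_promiseIsLiftRel {A : Language Bool}
    (hExt : PromiseBQPRel A ⊆ promiseLift (BQPRel A))
    (hSep : ¬ PromiseBQPRel A ⊆ PromiseBPP'Rel (Oracle.ofLanguage A)) :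
    ∃ L ∈ BQPRel A, L ∉ BPPRel (Oracle.ofLanguage A) := by
  by_contra hno
  refine hSep (hExt.trans ?_)
  refine (promiseLift_mono fun L hL => ?_).trans (promiseLift_BPPRel_subset_PromiseBPP'Rel _)
  by_contra hLB
  exact hno ⟨L, hL, hLB⟩

/-- Measure-one form: if `Q-EXT` and the weak promise separation both hold relative to a random
oracle, so does the summit. (Neither hypothesis is known; the second is Aaronson–Ambainis territory.)
[cite: AaronsonAmbainis2014, Thm. 7 (iii)] [cite: Fortnow1994, §6] -/
theorem ae_summitRel_of_ae
    (hExt : ∀ᵐ A : Set (List Bool) ∂randomOracleMeasure, PromiseBQPRel A ⊆ promiseLift (BQPRel A))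
    (hSep : ∀ᵐ A : Set (List Bool) ∂randomOracleMeasure,
      ¬ PromiseBQPRel A ⊆ PromiseBPP'Rel (Oracle.ofLanguage A)) :
    ∀ᵐ A : Set (List Bool) ∂randomOracleMeasure,
      ∃ L ∈ BQPRel A, L ∉ BPPRel (Oracle.ofLanguage A) := by
  filter_upwards [hExt, hSep] with A h1 h2
  exact summitRel_of_promiseIsLiftRel h1 h2

/-- **Summary of the quantum entries of the random column.** (i) `(∀ᵐ A, Q-III^A) → ¬ summit`;
(ii) `Q-III^A → Q-EXT^A` pointwise; (iii) `Q-EXT^A ∧ PSep'^A → summit^A` pointwise. Compare the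
classical entries (file 20): Hypothesis III, `C-EXT'`, `H₀` hold a.e. unconditionally.
[cite: FortnowRogers1999JCSS, Thm. 4.4 (arXiv numbering)] [cite: BennettGill1981, Thm. 5] -/
theorem quantumRung_randomColumn :
    ((∀ᵐ A : Set (List Bool) ∂randomOracleMeasure,
        PromiseBQPRel A ⊆ promiseLift (PRel (Oracle.ofLanguage A))) → ¬ QuantumAdvantage) ∧
      (∀ A : Language Bool, PromiseBQPRel A ⊆ promiseLift (PRel (Oracle.ofLanguage A)) →
        PromiseBQPRel A ⊆ promiseLift (BQPRel A)) ∧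
      ∀ A : Language Bool, PromiseBQPRel A ⊆ promiseLift (BQPRel A) →
        ¬ PromiseBQPRel A ⊆ PromiseBPP'Rel (Oracle.ofLanguage A) →
          ∃ L ∈ BQPRel A, L ∉ BPPRel (Oracle.ofLanguage A) :=
  ⟨not_quantumAdvantage_of_ae_quantumIII, fun _ => quantumIII_imp_promiseIsLiftRel,
    fun _ => summitRel_of_promiseIsLiftRel⟩

end Summit.QuantumAdvantage.QuantumAdvantage.Theorems

end
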